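import Summits.Ventures.CertifiedManyBodySolver.Downfold.EmeryFermiFillingRows
import Summits.Ventures.CertifiedManyBodySolver.Downfold.EmeryBandReduction
import HarnessLib

/-!
# The van Hove (Lifshitz) hole doping of the σ three-band antibonding band: the filling at which the Fermi level reaches the
# saddle-point energy `ε_AB(X)`, with a kernel-checkable sub-box rule

Venture CertifiedManyBodySolver, cell `pub/hubbard-downfold` (stage S1), seat hubbard-downfold-mod-4 (technique B); namespace
`Summit.Ventures.CertifiedManyBodySolver.Downfold.Emery`. Everything PROVED. WHAT THIS IS NOT: a statement about any material; no
number lives here; `U = 0` band kinematics of the σ model (`bloch4`); the identification of the LIFSHITZ transition of a material with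
this one-body crossing is the consumer's modelling claim, not this file's.

* §1 `vhEnergy Δ t_pd t_pp′ = abX(Δ + 4t_pp′, t_pd)` — the antibonding energy at X = (π, 0) (`abBand_at_X`: the characteristic cubic at
  `x = 1, y = 0` factorises as `(Δ + ε)(ε(Δ + 4t_pp′ + ε) − 4t_pd²)`); independent of `t_pp`. Rational BRACKET criteria without square
  roots: for `v ≥ 0`, `v² + (Δ + 4t_pp′)v − 4t_pd² ≤ 0 ⇒ v ≤ ε_VH` and `≥ 0 ⇒ ε_VH ≤ v` (`le_vhEnergy_of_quad_nonpos`,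
  `vhEnergy_le_of_quad_nonneg`).
* §2 `xVH Δ t_pd t_pp t_pp′ := 1 − 2·abFilling(ε_VH)` — the hole doping (per Cu, relative to half filling of the antibonding band) at
  which the σ-model Fermi level sits at the saddle point: the band-structure (Lifshitz / van Hove) doping of the three-band model.
* §3 THE SUB-BOX RULE `xVH_window_of_checks`: rational side conditions (`vhSubBoxCheck`) + a row-threshold OUTER count at the upper
  bracket `v₂` + a row-threshold INNER count at the lower bracket `v₁` (`EmeryFermiFillingRows`) ⇒ `xVH ∈ [1 − 2·rowSum(out)/K²,
  1 − 2·rowSum(in)/K²]` at every point of the parameter sub-box. All premises are decided by the kernel in consumers.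
  PRECISION NOTE (honest): this rule DECOUPLES `ε_VH(p)` from `p` inside the sub-box; because the band and its saddle energy co-move
  with `Δ_pd`, the decoupling loss is large (on the La-214 one-body rows split 8 × 2 the windows come out ≈ [−0.2, 0.55] around a
  float truth x_VH ∈ [0.14, 0.27]) — a useful window needs either very fine sub-boxes or a joint treatment (substitute
  `ε = vhEnergy(p)` symbolically: `abX² = 4t_pd² − (Δ + 4t_pp′)·abX` makes `charCubic(·, ε_VH)` affine in `abX` with polynomial
  coefficients). The definitions and §1 are the durable part.

Consumer: none yet (see the precision note). Sources: [HybertsenSchluterChristensen1989, Eq. (1)]; [AndersenEtAl1995, §6] (saddle point at X of the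
`t–t′` form).
-/

noncomputable section

namespace Summit.Ventures.CertifiedManyBodySolver.Downfold.Emery

open Real Set

/-! ## §1 The saddle-point energy and its rational brackets -/

/-- The antibonding energy at X = (π, 0): `ε_VH = abX(Δ + 4t_pp′, t_pd)` (the `t_pp′` hopping shifts the oxygen level seen at X by
`4t_pp′`, cf. `EmeryBandReductionAcrossCu.det_bloch4_X_abX`). [folklore] -/
def vhEnergy (Δ tpd c : ℝ) : ℝ := abX (Δ + 4 * c) tpd

/-- `0 ≤ ε_VH`. [folklore] -/
theorem vhEnergy_nonneg (Δ tpd c : ℝ) : 0 ≤ vhEnergy Δ tpd c := abX_nonneg _ _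

/-- The secular equation at X: `ε_VH² + (Δ + 4t_pp′)ε_VH − 4t_pd² = 0`. [folklore] -/
theorem vhEnergy_quad (Δ tpd c : ℝ) :
    vhEnergy Δ tpd c ^ 2 + (Δ + 4 * c) * vhEnergy Δ tpd c - 4 * tpd ^ 2 = 0 := by
  have h := abX_secular (Δ + 4 * c) tpd
  unfold vhEnergy
  nlinarith [h]

/-- LOWER BRACKET CRITERION: `0 ≤ Δ + 4t_pp′`, `v² + (Δ + 4t_pp′)v − 4t_pd² ≤ 0 ⇒ v ≤ ε_VH`. [folklore] -/
theorem le_vhEnergy_of_quad_nonpos {Δ tpd c v : ℝ} (hD : 0 ≤ Δ + 4 * c)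
    (h : v ^ 2 + (Δ + 4 * c) * v - 4 * tpd ^ 2 ≤ 0) : v ≤ vhEnergy Δ tpd c := by
  have hq := vhEnergy_quad Δ tpd c
  have he := vhEnergy_nonneg Δ tpd c
  refine le_of_not_gt fun hlt => ?_
  -- f(v) − f(ε_VH) = (v − ε_VH)(v + ε_VH + D) > 0
  have : 0 < (v - vhEnergy Δ tpd c) * (v + vhEnergy Δ tpd c + (Δ + 4 * c)) :=
    mul_pos (by linarith) (by linarith)
  nlinarith

/-- UPPER BRACKET CRITERION: `0 ≤ v`, `0 ≤ Δ + 4t_pp′`, `0 ≤ v² + (Δ + 4t_pp′)v − 4t_pd²` ⇒ `ε_VH ≤ v`. [folklore] -/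
theorem vhEnergy_le_of_quad_nonneg {Δ tpd c v : ℝ} (hv : 0 ≤ v) (hD : 0 ≤ Δ + 4 * c)
    (h : 0 ≤ v ^ 2 + (Δ + 4 * c) * v - 4 * tpd ^ 2) : vhEnergy Δ tpd c ≤ v := by
  have hq := vhEnergy_quad Δ tpd c
  have he := vhEnergy_nonneg Δ tpd c
  refine le_of_not_gt fun hlt => ?_
  have : 0 < (vhEnergy Δ tpd c - v) * (v + vhEnergy Δ tpd c + (Δ + 4 * c)) :=
    mul_pos (by linarith) (by linarith)
  nlinarith

/-- At X = (π, 0) (`x = 1`, `y = 0`) the characteristic cubic factorises: `charCubic = (Δ + ε)(ε(Δ + 4t_pp′ + ε) − 4t_pd²)`. [folklore] -/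
theorem charCubic_at_X (Δ tpd tpp c ε : ℝ) :
    charCubic Δ tpd tpp c 1 0 ε = (Δ + ε) * (ε * (Δ + 4 * c + ε) - 4 * tpd ^ 2) := by
  unfold charCubic; ring

/-- **The antibonding band at X is `ε_VH`** (`Δ ≥ 0`, `t_pp′ ≥ 0`). [folklore] -/
theorem abBand_at_X {Δ : ℝ} (hΔ : 0 ≤ Δ) (tpd tpp : ℝ) {c : ℝ} (hc : 0 ≤ c) :
    abBand Δ tpd tpp c 1 0 = vhEnergy Δ tpd c := by
  apply le_antisymm
  · -- every root `r` of the cubic at X satisfies `r = −Δ ≤ 0 ≤ ε_VH` or the quadratic, whose top root is `ε_VH`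
    have hroot := charCubic_abBand Δ tpd tpp c 1 0
    set r := abBand Δ tpd tpp c 1 0
    rw [charCubic_at_X] at hroot
    rcases mul_eq_zero.1 hroot with h1 | h2
    · have : r = -Δ := by linarith
      rw [this]; exact (neg_nonpos.2 hΔ).trans (vhEnergy_nonneg _ _ _)
    · refine le_of_not_gt fun hlt => ?_
      have he := vhEnergy_nonneg Δ tpd c
      have hq := vhEnergy_quad Δ tpd c
      have : 0 < (r - vhEnergy Δ tpd c) * (r + vhEnergy Δ tpd c + (Δ + 4 * c)) :=
        mul_pos (by linarith) (by nlinarith)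
      nlinarith
  · -- `ε_VH` is a root, hence below the top root
    apply le_abBand_of_charCubic_eq_zero
    rw [charCubic_at_X]
    have hq := vhEnergy_quad Δ tpd c
    have : vhEnergy Δ tpd c * (Δ + 4 * c + vhEnergy Δ tpd c) - 4 * tpd ^ 2 = 0 := by nlinarith [hq]
    rw [this, mul_zero]

/-! ## §2 The van Hove hole doping -/

/-- THE VAN HOVE (LIFSHITZ) HOLE DOPING of the σ three-band model: `x_VH = 1 − 2·abFilling(ε_VH)` — the hole count per Cu,
relative to the half-filled antibonding band, at which the Fermi level reaches the saddle-point energy `ε_AB(X)`.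
[cite: HybertsenSchluterChristensen1989, Eq. (1) (three-band d–p model)] -/
def xVH (Δ tpd tpp c : ℝ) : ℝ := 1 - 2 * abFilling Δ tpd tpp c (vhEnergy Δ tpd c)

/-! ## §3 The sub-box rule -/

/-- Rational side conditions of a van Hove sub-box certificate: box order/positivity, the two bracket criteria at the worst corners
(`v₁² + (Δ₂ + 4c₂)v₁ − 4a₁² ≤ 0`, `0 ≤ v₂² + (Δ₁ + 4c₁)v₂ − 4a₂²`), and the coefficient bounds for the OUTER count at `v₂` and the
INNER count at `v₁`. [folklore] -/
def vhSubBoxCheck (Δ₁ Δ₂ a₁ a₂ b₁ b₂ c₁ c₂ v₁ v₂ Ahi Dlo Nlo Alo Dhi Nhi : ℚ) : Bool :=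
  decide (0 < a₁) && decide (a₁ ≤ a₂) && decide (0 ≤ c₁) && decide (c₁ ≤ c₂) && decide (c₂ < b₁) &&
  decide (b₁ ≤ b₂) && decide (0 < Δ₁) && decide (Δ₁ ≤ Δ₂) && decide (0 ≤ v₁) && decide (v₁ ≤ v₂) &&
  decide (2 * c₂ * v₂ ≤ a₁ ^ 2) &&
  decide (v₁ ^ 2 + (Δ₂ + 4 * c₂) * v₁ - 4 * a₁ ^ 2 ≤ 0) && decide (0 ≤ v₂ ^ 2 + (Δ₁ + 4 * c₁) * v₂ - 4 * a₂ ^ 2) &&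
  decide (v₂ * (Δ₂ + v₂) ^ 2 ≤ Ahi) && decide (Dlo ≤ (Δ₁ + v₂) * (a₁ ^ 2 - c₂ * v₂)) &&
  decide (Nlo ≤ (c₁ + b₁) * (2 * a₁ ^ 2 + v₂ * (b₁ - c₂))) && decide (0 ≤ Dlo) && decide (0 ≤ Nlo) &&
  decide (Alo ≤ v₁ * (Δ₁ + v₁) ^ 2) && decide ((Δ₂ + v₁) * (a₂ ^ 2 - c₁ * v₁) ≤ Dhi) &&
  decide ((c₂ + b₂) * (2 * a₂ ^ 2 + v₁ * (b₂ - c₁)) ≤ Nhi) && decide (0 ≤ Dhi) && decide (0 ≤ Nhi)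

/-- **THE VAN HOVE SUB-BOX RULE.** On a sub-box passing `vhSubBoxCheck`, a row-threshold outer count at `v₂` and a row-threshold
inner count at `v₁` certify, for every parameter point: `ε_VH ∈ [v₁, v₂]` and
`x_VH ∈ [1 − 2·rowSum(out)/K², 1 − 2·rowSum(in)/K²]`. [folklore] -/
theorem xVH_window_of_checks {K : ℕ} (hK : 0 < K) {xl xh : ℕ → ℚ} (hG : GridEncl K xl xh)
    {Δ₁ Δ₂ a₁ a₂ b₁ b₂ c₁ c₂ v₁ v₂ Ahi Dlo Nlo Alo Dhi Nhi : ℚ} {jout jin : ℕ → ℕ}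
    (hchk : vhSubBoxCheck Δ₁ Δ₂ a₁ a₂ b₁ b₂ c₁ c₂ v₁ v₂ Ahi Dlo Nlo Alo Dhi Nhi = true)
    (hOut : rowOuterCheck K xl Ahi Dlo Nlo jout = true)
    (hIn : rowInnerCheck K xh v₁ Alo Dhi Nhi Δ₁ (a₂ ^ 2) (b₂ ^ 2) jin = true)
    {Δ tpd tpp c : ℝ} (hΔ : Δ ∈ Set.Icc (Δ₁ : ℝ) Δ₂) (ha : tpd ∈ Set.Icc (a₁ : ℝ) a₂)
    (hb : tpp ∈ Set.Icc (b₁ : ℝ) b₂) (hc : c ∈ Set.Icc (c₁ : ℝ) c₂) :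
    vhEnergy Δ tpd c ∈ Set.Icc (v₁ : ℝ) v₂ ∧
      xVH Δ tpd tpp c ∈ Set.Icc (1 - 2 * (((rowSum K jout : ℕ) : ℝ) / (K : ℝ) ^ 2))
        (1 - 2 * (((rowSum K jin : ℕ) : ℝ) / (K : ℝ) ^ 2)) := by
  simp only [vhSubBoxCheck, Bool.and_eq_true, decide_eq_true_eq] at hchk
  obtain ⟨⟨⟨⟨⟨⟨⟨⟨⟨⟨⟨⟨⟨⟨⟨⟨⟨⟨⟨⟨⟨⟨qa₁, qa⟩, qc₁⟩, qc⟩, qcb⟩, qb⟩, qΔ₁⟩, qΔ⟩, qv₁⟩, qv⟩, qcap⟩,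
    qlo⟩, qhi⟩, qAhi⟩, qDlo⟩, qNlo⟩, qDlo0⟩, qNlo0⟩, qAlo⟩, qDhi⟩, qNhi⟩, qDhi0⟩, qNhi0⟩ := hchk
  obtain ⟨hΔlo, hΔhi⟩ := hΔ
  obtain ⟨halo, hahi⟩ := ha
  obtain ⟨hblo, hbhi⟩ := hb
  obtain ⟨hclo, hchi⟩ := hc
  have ra₁ : (0 : ℝ) < a₁ := by exact_mod_cast qa₁
  have rc₁ : (0 : ℝ) ≤ c₁ := by exact_mod_cast qc₁
  have rcb : (c₂ : ℝ) < b₁ := by exact_mod_cast qcb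
  have rΔ₁ : (0 : ℝ) < Δ₁ := by exact_mod_cast qΔ₁
  have rv₁ : (0 : ℝ) ≤ v₁ := by exact_mod_cast qv₁
  have rv : (v₁ : ℝ) ≤ v₂ := by exact_mod_cast qv
  have rcap : 2 * (c₂ : ℝ) * v₂ ≤ (a₁ : ℝ) ^ 2 := by exact_mod_cast qcap
  have hc0 : 0 ≤ c := rc₁.trans hclo
  have hc₂0 : (0 : ℝ) ≤ c₂ := hc0.trans hchi
  have htpd : 0 < tpd := lt_of_lt_of_le ra₁ halo
  have hb₁0 : (0 : ℝ) ≤ b₁ := hc₂0.trans rcb.le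
  have rv₂ : (0 : ℝ) ≤ v₂ := rv₁.trans rv
  have hD : 0 ≤ Δ + 4 * c := by nlinarith
  -- the bracket
  have hlo : (v₁ : ℝ) ≤ vhEnergy Δ tpd c := by
    refine le_vhEnergy_of_quad_nonpos hD ?_
    have q : (v₁ : ℝ) ^ 2 + ((Δ₂ : ℝ) + 4 * c₂) * v₁ - 4 * (a₁ : ℝ) ^ 2 ≤ 0 := by exact_mod_cast qlo
    have e1 : (Δ + 4 * c) * (v₁ : ℝ) ≤ ((Δ₂ : ℝ) + 4 * c₂) * v₁ := mul_le_mul_of_nonneg_right (by linarith) rv₁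
    have e2 : (a₁ : ℝ) ^ 2 ≤ tpd ^ 2 := pow_le_pow_left₀ ra₁.le halo 2
    linarith
  have hhi : vhEnergy Δ tpd c ≤ (v₂ : ℝ) := by
    refine vhEnergy_le_of_quad_nonneg rv₂ hD ?_
    have q : (0 : ℝ) ≤ (v₂ : ℝ) ^ 2 + ((Δ₁ : ℝ) + 4 * c₁) * v₂ - 4 * (a₂ : ℝ) ^ 2 := by exact_mod_cast qhi
    have e1 : ((Δ₁ : ℝ) + 4 * c₁) * v₂ ≤ (Δ + 4 * c) * (v₂ : ℝ) := mul_le_mul_of_nonneg_right (by linarith) rv₂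
    have e2 : tpd ^ 2 ≤ (a₂ : ℝ) ^ 2 := pow_le_pow_left₀ htpd.le hahi 2
    linarith
  refine ⟨⟨hlo, hhi⟩, ?_⟩
  have hcap₁ : (c₂ : ℝ) * v₁ ≤ (a₁ : ℝ) ^ 2 := by nlinarith [mul_nonneg hc₂0 rv₁]
  have hcap₂ : (c₂ : ℝ) * v₂ ≤ (a₁ : ℝ) ^ 2 := by nlinarith [mul_nonneg hc₂0 rv₂]
  -- OUTER at v₂
  have hOutR : abFilling Δ tpd tpp c v₂ ≤ ((rowSum K jout : ℕ) : ℝ) / (K : ℝ) ^ 2 := by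
    refine abFilling_le_rowSum_outer hK hG hOut ?_ ?_ ?_ qDlo0 qNlo0
    · have h1 : (Δ + v₂) ^ 2 ≤ ((Δ₂ : ℝ) + v₂) ^ 2 := pow_le_pow_left₀ (by linarith) (by linarith) 2
      have h2 : (v₂ : ℝ) * ((Δ₂ : ℝ) + v₂) ^ 2 ≤ Ahi := by exact_mod_cast qAhi
      unfold cA; nlinarith [mul_le_mul_of_nonneg_left h1 rv₂]
    · have hDm := (fsD_mem_Icc (Δ := Δ) (tpd := tpd) (c := c) (ε := (v₂ : ℝ)) ra₁.le rc₁ rv₂ (by linarith)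
        hcap₂ ⟨hΔlo, hΔhi⟩ ⟨halo, hahi⟩ ⟨hclo, hchi⟩ ⟨le_rfl, le_rfl⟩).1
      have h2 : (Dlo : ℝ) ≤ ((Δ₁ : ℝ) + v₂) * ((a₁ : ℝ) ^ 2 - c₂ * v₂) := by exact_mod_cast qDlo
      exact h2.trans hDm
    · have hNm := (fsN_mem_Icc (tpd := tpd) (tpp := tpp) (c := c) (ε := (v₂ : ℝ)) ra₁.le hb₁0 rc₁ rv₂
        hcap₂ ⟨halo, hahi⟩ ⟨hblo, hbhi⟩ ⟨hclo, hchi⟩ ⟨le_rfl, le_rfl⟩).1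
      rw [min_self] at hNm
      have h2 : (Nlo : ℝ) ≤ ((c₁ : ℝ) + b₁) * (2 * (a₁ : ℝ) ^ 2 + v₂ * (b₁ - c₂)) := by exact_mod_cast qNlo
      exact h2.trans hNm
  -- INNER at v₁
  have hInR : ((rowSum K jin : ℕ) : ℝ) / (K : ℝ) ^ 2 ≤ abFilling Δ tpd tpp c v₁ := by
    refine rowSum_inner_le_abFilling hK hG hIn ?_ ?_ ?_ qDhi0 qNhi0 hΔlo qΔ₁.le hc0 ?_ ?_ qv₁
    · have h1 : ((Δ₁ : ℝ) + v₁) ^ 2 ≤ (Δ + v₁) ^ 2 := pow_le_pow_left₀ (by linarith) (by linarith) 2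
      have h2 : (Alo : ℝ) ≤ (v₁ : ℝ) * ((Δ₁ : ℝ) + v₁) ^ 2 := by exact_mod_cast qAlo
      unfold cA; nlinarith [mul_le_mul_of_nonneg_left h1 rv₁]
    · have hDm := (fsD_mem_Icc (Δ := Δ) (tpd := tpd) (c := c) (ε := (v₁ : ℝ)) ra₁.le rc₁ rv₁ (by linarith)
        hcap₁ ⟨hΔlo, hΔhi⟩ ⟨halo, hahi⟩ ⟨hclo, hchi⟩ ⟨le_rfl, le_rfl⟩).2
      have h2 : ((Δ₂ : ℝ) + v₁) * ((a₂ : ℝ) ^ 2 - c₁ * v₁) ≤ Dhi := by exact_mod_cast qDhi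
      exact hDm.trans h2
    · have hNm := (fsN_mem_Icc (tpd := tpd) (tpp := tpp) (c := c) (ε := (v₁ : ℝ)) ra₁.le hb₁0 rc₁ rv₁
        hcap₁ ⟨halo, hahi⟩ ⟨hblo, hbhi⟩ ⟨hclo, hchi⟩ ⟨le_rfl, le_rfl⟩).2
      rw [max_self] at hNm
      have h2 : ((c₂ : ℝ) + b₂) * (2 * (a₂ : ℝ) ^ 2 + v₁ * (b₂ - c₁)) ≤ Nhi := by exact_mod_cast qNhi
      exact hNm.trans h2
    · push_cast; exact pow_le_pow_left₀ htpd.le hahi 2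
    · push_cast; exact pow_le_pow_left₀ (hb₁0.trans hblo) hbhi 2
  -- monotonicity between the brackets
  have m1 := abFilling_mono Δ tpd tpp c hlo
  have m2 := abFilling_mono Δ tpd tpp c hhi
  unfold xVH
  constructor <;> linarith
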